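import Literature.MathematicalPhysics.QuantumFieldTheory.Balaban1983to89.B9Eq3153FrakGkBoundDiagonal
import Literature.MathematicalPhysics.QuantumFieldTheory.Balaban1983to89.B9Eq386GreenLipschitzEnergy

/-!
# `Balaban1983to89.B9Eq3130HessianSlotPerturbationDiagonal` — T. Bałaban, *Propagators for lattice gauge theories in a background field*, Commun. Math. Phys.
# **99** (1985) 389–434 [Balaban1985BackgroundPropagators] (3.130) p. 421 *«G = G₀(I − Δ′_πG₀)⁻¹»* with (3.120) p. 419, (3.122) p. 420, Thm 3.11 p. 416 and
# Thm 3.4 p. 400, ON PRINT's DIAGONAL `ηL^{n+1} = 1`, IN THE ENERGY CURRENCY: a perturbation of the HESSIAN SLOT of the `k`-th-step operator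
# `Δ_{a,k}(U) = Δ₁ + D_U R_k D*_U + Q_k* a Q_k` by a form-small `Δ₁ − Δ^η(U)` (print's `Δ′_π`) keeps the strong coercivity, the positivity and the Green's
# function up to `O(θ)` in the flat energy norm — `∃ α₀ γ₁` BEFORE EVERY BINDER, the form letter `θ` displayed

statement-level skeleton of published theorems with citation tags; proofs where landed; nothing here is a claim about the Yang–Mills mass gap

CITATION HEADER (lean-in-tree rule).  Audit cell `pub-balaban`, sub-cell `t4`, BINDER row NE9; filed by the row OWNER lineage `b2b-balaban-t4-ne9-p1`
(gen 87; plan v7 «the Δ_π port», steps (iii) + (iv-G) MODULO the one new estimate (ii), `g87/DELTA-PI-PROGRAMME.md`).  Sources READ by this lineage in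
the held texts: [Balaban1985BackgroundPropagators] pp. 416, 419–421 (`paper:balaban1985-cmp99-background-propagators`, journal page = PDF page + 388).

THE PRINT (verbatim).  p. 420: *«It differs from the operator investigated in previous sections by the additional term Δ′_π, but we will prove that this
term is a small perturbation of Δ_a, and that the operator G used in the above formula has all the properties formulated in Theorems 3.3, 3.10, 3.11»*;
p. 421: *«Let us denote for a moment the operator we have investigated in previous sections by G₀, i.e. G₀ = (Δ + DRD* + Q*aQ)⁻¹. From (3.120) we get
G = G₀(I − Δ′_πG₀)⁻¹ (3.130)»*.

WHY THIS FILE (cell context; DIAGNOSIS D-ne9p1-g87-1, journal l.51114).  The chain's `B9Eq326OperatorTower.laplaceAk` is print's `G₀⁻¹` (the bare Hessian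
`hessOp` (3.10) in the `Δ₁`-slot of `B11Eq103H1Complex.laplaceALatticeK`); print's `H`∕`𝔊` of (3.126)∕(3.153) live on `G̃⁻¹ = Δ_π + DRD* + Q*aQ` (3.122) —
the SAME operator with the gauge-invariant extension `Δ_π = π†Δ^ηπ` in the `Δ₁`-slot (`B9Eq3119DeltaPiTower.laplaceAkPi`, this generation).  Print passes
from `G₀` to `G` by (3.130) once `Δ′_π = Δ_π − Δ` is «a small perturbation».  This file is that passage IN THE ENERGY CURRENCY and ABSTRACT IN THE SLOT:
for ANY operator `Δ₁` on the bond `L²` space whose FORM defect against `Δ^η(U)` is `θ·N₁(u)N₁(v)`-small in the flat energy weight (the displayed letter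
`θ` — for `Δ₁ := Δ_π` it is the port's step (ii), (3.120) + (3.36), NOT in the tree), the operator `Δ₁ + D_U R_k(U) D*_U + Q_k(U)* a Q_k(U)` inherits on the
diagonal: STRONG coercivity `γ₁∕2`, positive definiteness (so the `hpos` of `B9Eq3119DeltaPiTower` is INHABITED given `θ ≤ γ₁∕2`), `‖G₁‖ ≤ 2∕γ₁`, and
`G₁ − G₀ = O(θ)` in the flat energy norm — (3.130) to FIRST order with NO Neumann series (`B9Eq386GreenLipschitzEnergy.weight_green_sub_le`).

WHAT IS PROVED (sorry-free; no `def`, no `Prop` placeholder; no inequality of the paper asserted hypothesis-free).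
* **`exists_hessian_slot_perturbation_diagonal`** — there are `α₀, γ₁ > 0` (`γ₁ = γ(d,a)∕4`, `α₀` closed in `(d, a, L, M_φ, M_φ′, r, C_τ, ρ_w)`; the SAME as
  `B9Eq3153FrakGkBoundDiagonal.exists_energy_letters_diagonal_closed`) such that for every `n`, `η` (`ηL^{n+1} = 1`), `c₀, c₁` (`c₀(L^{n+1})^d = c₁`,
  `|η|^d∕c₀ ≤ ρ_w`), `m`, background `U` of E162's data with `hRS`, `U(b) ∈ U1`, in the windows `‖U(b) − 1‖ ≤ αη`, `‖U(∂p) − 1‖ ≤ αη²`, `ε_j ≤ αr^j`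
  (`0 ≤ α ≤ α₀`), every operator `Δ₁` and every `0 ≤ θ ≤ γ₁∕2` with `‖⟨u, Δ₁v⟩ − ⟨u, Δ^η(U)v⟩‖ ≤ θ·N₁(u)N₁(v)` (`N₁(u)² = ‖curl₁u‖² + ‖div₁u‖² + ‖u‖²`,
  flat derivative letters): (a) `(γ₁∕2)·N₁(x)² ≤ re⟨x, Δ₁_{a,k}(U)x⟩` for `Δ₁_{a,k}(U) := laplaceALatticeK η⁻¹ R(U) R(U⁻¹) Δ₁ (R_k(U)) (Q_k(U)) a`;
  (b) `0 < re⟨x, Δ₁_{a,k}(U)x⟩` for `x ≠ 0`; (c) for ANY positivity witnesses `hpos₁` (of `Δ₁_{a,k}(U)`) and `hposU` (of `Δ_{a,k}(U)`) and every `y`: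
  `‖G₁y − G₀y‖, ‖curl₁(G₁y − G₀y)‖, ‖div₁(G₁y − G₀y)‖ ≤ (2∕γ₁²)·θ·‖y‖` with `G₁ = greenK (Δ₁_{a,k}(U)) hpos₁`, `G₀ = greenK (Δ_{a,k}(U)) hposU` = the
  chain's `G_k(U)`.  MECHANISM: `⟨u, Δ₁_{a,k}v⟩ − ⟨u, Δ_{a,k}v⟩ = ⟨u, Δ₁v⟩ − ⟨u, Δ^ηv⟩` (`laplaceAK_apply`: the `DRD*` and `Q*aQ` parts coincide), the
  strong coercivity `γ₁` of `B9Eq3153FrakGkBoundDiagonal` §1, `re z ≥ −‖z‖`, and `B9Eq386GreenLipschitzEnergy.weight_green_le` ∕ `weight_green_sub_le_of_bound`.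
HONEST SCOPE.  [folklore] two-line coercivity arithmetic + composition by name; the form letter `θ` IS the content of print's «small perturbation» and is
DISPLAYED (for `Δ₁ := π_k†Δ^ηπ_k` it is (3.120) + (3.36) at the k-th-step letters — OPEN, plan v7 (ii)); ENERGY currency on the diagonal only, no Neumann
series, no operator norm of `Δ′_π`, no decay, not the (N)-reading; the windows, E162's data, `hRS`, `ρ_w`, the trace letter and the witnesses stay HYPOTHESES.
NOT summit progress (cell pub-balaban: NE9 NOT PRINTED ∕ NOT PROVED; «NE9 ⇐ the named binders»; row WALLED ON A MODEL (O-NE9-1; #5 UNRULED); spine PROVED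
0∕9; rung (B)+1 finite T⁴ — NOT infinite volume, NOT mass gap, NOT BetaPertH, NOT Clay).  HONEST DEPENDENCY (cell line): continuum YM on T⁴ ⇐ BetaPertH ∧
nine spine estimates (0/9 proved); BetaPertH ⇐ (D1) ∧ (D4) ∧ CAP+tail; G-an2-4 gates asym, D1 and NE2/3/4.  NEW file; nothing modified.  Net new unproved facts: 0.
-/

noncomputable section

open scoped InnerProductSpace ComplexConjugate BigOperators

namespace Literature.MathematicalPhysics.QuantumFieldTheory.Balaban1983to89.B9Eq3130HessianSlotPerturbationDiagonal

open B4Sect5Torus (TSite)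
open B9SectCLatticeCarrier (Bond)
open B11Eq103H1Complex (SiteL2K BondL2K covDerivL2K covDivL2K laplaceALatticeK laplaceAK laplaceAK_apply greenK)
open B9Eq310HessianOperator (adTransportW hessOp covCurlL2K)
open B9Eq310DeltaPrime (plaqHolU)
open B9Eq315QTorus (perCfg cornerSite)
open B9Eq315QTower (towerP UlevOf)
open B9Eq326OperatorTower (laplaceAk QkW RofUk)
open B7Prop1Explicit (U1 Wcx boxVec)
open B9Eq3153FrakGkBoundDiagonal (exists_energy_letters_diagonal_closed)
open B9Eq386GreenLipschitzEnergy (weight_green_le weight_green_sub_le_of_bound)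

/-! ## §1 Arithmetic -/

/-- `x ≤ √S` from `0 ≤ x` and `x² ≤ S`. [folklore] -/
private theorem le_sqrt_of_sq_le {x S : ℝ} (hx : 0 ≤ x) (h : x ^ 2 ≤ S) : x ≤ Real.sqrt S := by
  calc x = Real.sqrt (x ^ 2) := (Real.sqrt_sq hx).symm
    _ ≤ Real.sqrt S := Real.sqrt_le_sqrt h

/-- The real part of a difference is at least minus its norm. [folklore] -/
private theorem re_sub_ge {z w : ℂ} {B : ℝ} (h : ‖z - w‖ ≤ B) : RCLike.re w - B ≤ RCLike.re z := by
  have h1 : |RCLike.re (z - w)| ≤ ‖z - w‖ := RCLike.abs_re_le_norm (z - w)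
  have h2 : -(‖z - w‖) ≤ RCLike.re (z - w) := neg_le_of_abs_le h1
  rw [map_sub] at h2
  linarith

/-! ## §2 The Hessian slot perturbed by a form-small operator, on the diagonal -/

variable {d : ℕ} (L : ℕ) [NeZero L] (hL : 1 ≤ L)
  {𝔸 : Type*} [NormedRing 𝔸] [NormedAlgebra ℂ 𝔸] [CompleteSpace 𝔸] [NormOneClass 𝔸] [StarRing 𝔸] [NormedStarGroup 𝔸] [StarModule ℂ 𝔸]
  {W : Type*} [NormedAddCommGroup W] [InnerProductSpace ℂ W] [FiniteDimensional ℂ W] (φ : W ≃ₗ[ℂ] 𝔸)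
  {Mφ Mφ' : ℝ} (hMφ : 0 ≤ Mφ) (hMφ' : 0 ≤ Mφ') (hφ : ∀ w, ‖φ w‖ ≤ Mφ * ‖w‖) (hφ' : ∀ X, ‖φ.symm X‖ ≤ Mφ' * ‖X‖)
  {a : ℝ} (ha : 0 < a) {r : ℝ} (hr0 : 0 ≤ r) (hr1 : r < 1)
  (τ : 𝔸 →ₗ[ℂ] ℂ) {Cτ : ℝ} (hτ : ∀ X, ‖τ X‖ ≤ Cτ * ‖X‖) (hCτ : 0 ≤ Cτ) {ρw : ℝ} (hρw : 0 ≤ ρw)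

include hMφ hMφ' hφ hφ' ha hr0 hr1 hτ hCτ hρw

/-- **(3.130) IN THE ENERGY CURRENCY ON THE DIAGONAL, ABSTRACT IN THE HESSIAN SLOT** — see the module header: `∃ α₀ γ₁ > 0` before every binder; for
every slot operator `Δ₁` with form defect `θ·N₁(u)N₁(v)` against `Δ^η(U)`, `0 ≤ θ ≤ γ₁∕2`: (a) `γ₁∕2`-strong coercivity of `Δ₁ + D_UR_kD*_U + Q_k*aQ_k`,
(b) its positive definiteness, (c) `G₁ − G₀ = O(θ)` in the flat energy norm with constant `2∕γ₁²`, for ANY positivity witnesses.  For `Δ₁ := π_k†Δ^ηπ_k`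
(`B9Eq3119DeltaPiTower.laplaceAkPi`) this is print's passage `G₀ ↦ G̃` modulo the one letter `θ` ((3.120) + (3.36)). [folklore]
[cite: Balaban1985BackgroundPropagators, (3.130) p.421, (3.120) p.419, (3.122) p.420, Thm 3.11 p.416, Thm 3.4 p.400] -/
theorem exists_hessian_slot_perturbation_diagonal :
    ∃ α₀ γ₁ : ℝ, 0 < α₀ ∧ 0 < γ₁ ∧ ∀ (n : ℕ) (η : ℝ), η * (L : ℝ) ^ (n + 1) = 1 →
      ∀ (c₀ c₁ : ℝ) [Fact (0 < c₀)] [Fact (0 < c₁)], c₀ * ((L : ℝ) ^ (n + 1)) ^ d = c₁ → |η| ^ d / c₀ ≤ ρw →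
      ∀ (m : Fin d → ℕ) [∀ i, NeZero (m i)] (U : Bond d (towerP L m (n + 1)) → 𝔸ˣ) (αU : ℕ → ℝ) (hα1 : ∀ j, αU j ≤ 1 / 64)
        (hU1 : ∀ (j : ℕ) (x : B7Prop1Explicit.Site d) (κ : Fin d), perCfg (towerP L m (j + 1)) (UlevOf L m (n + 1) U j) x κ ∈ U1 𝔸)
        (hreg : ∀ (j : ℕ) (y : TSite d (towerP L m j)) (κ : Fin d) (r : Fin d → Fin L),
          ‖((Wcx L (perCfg (towerP L m (j + 1)) (UlevOf L m (n + 1) U j)) (cornerSite L y) κ (boxVec L r) : 𝔸ˣ) : 𝔸) - 1‖ ≤ αU j)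
        (εU : ℕ → ℝ), (∀ j, 0 ≤ εU j) → (∀ (j : ℕ) (b : Bond d (towerP L m (j + 1))), ‖(UlevOf L m (n + 1) U j b : 𝔸) - 1‖ ≤ εU j) →
      ∀ {α : ℝ}, 0 ≤ α → α ≤ α₀ →
        (∀ (b : Bond d (towerP L m (n + 1))) (v u : W), ⟪adTransportW φ U b v, u⟫_ℂ = ⟪v, adTransportW φ (fun b => (U b)⁻¹) b u⟫_ℂ) →
        (∀ b, U b ∈ U1 𝔸) → (∀ b, ‖(U b : 𝔸) - 1‖ ≤ α * η) →
        (∀ p : B9SectCLatticeCarrier.Plaq d (towerP L m (n + 1)), ‖(plaqHolU U p : 𝔸) - 1‖ ≤ α * η ^ 2) →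
        (∀ j < n + 1, εU j ≤ α * r ^ j) →
        ∀ (Δ₁ : BondL2K ℂ d (towerP L m (n + 1)) c₀ W →ₗ[ℂ] BondL2K ℂ d (towerP L m (n + 1)) c₀ W) {θ : ℝ}, 0 ≤ θ → θ ≤ γ₁ / 2 →
        (∀ u v : BondL2K ℂ d (towerP L m (n + 1)) c₀ W, ‖⟪u, Δ₁ v⟫_ℂ - ⟪u, hessOp φ η U τ v⟫_ℂ‖ ≤
            θ * Real.sqrt (‖covCurlL2K ℂ c₀ ((η : ℂ))⁻¹ (adTransportW φ (fun _ : Bond d (towerP L m (n + 1)) => (1 : 𝔸ˣ))) u‖ ^ 2 +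
                  ‖covDivL2K ℂ c₀ ((η : ℂ))⁻¹ (adTransportW φ fun _ : Bond d (towerP L m (n + 1)) => (1 : 𝔸ˣ)⁻¹) u‖ ^ 2 + ‖u‖ ^ 2) *
                Real.sqrt (‖covCurlL2K ℂ c₀ ((η : ℂ))⁻¹ (adTransportW φ (fun _ : Bond d (towerP L m (n + 1)) => (1 : 𝔸ˣ))) v‖ ^ 2 +
                  ‖covDivL2K ℂ c₀ ((η : ℂ))⁻¹ (adTransportW φ fun _ : Bond d (towerP L m (n + 1)) => (1 : 𝔸ˣ)⁻¹) v‖ ^ 2 + ‖v‖ ^ 2)) →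
        -- (a) strong coercivity of the perturbed operator
        (∀ x : BondL2K ℂ d (towerP L m (n + 1)) c₀ W,
          γ₁ / 2 * (‖covCurlL2K ℂ c₀ ((η : ℂ))⁻¹ (adTransportW φ (fun _ : Bond d (towerP L m (n + 1)) => (1 : 𝔸ˣ))) x‖ ^ 2 +
              ‖covDivL2K ℂ c₀ ((η : ℂ))⁻¹ (adTransportW φ fun _ : Bond d (towerP L m (n + 1)) => (1 : 𝔸ˣ)⁻¹) x‖ ^ 2 + ‖x‖ ^ 2) ≤
            RCLike.re ⟪x, laplaceALatticeK ((η : ℂ))⁻¹ (adTransportW φ U) (adTransportW φ fun b => (U b)⁻¹) Δ₁ (RofUk L m n φ η U)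
              (QkW L m n φ U hL αU hα1 hU1 hreg (c₁ := c₁)) a x⟫_ℂ) ∧
        -- (b) positive definiteness
        (∀ x : BondL2K ℂ d (towerP L m (n + 1)) c₀ W, x ≠ 0 →
          0 < RCLike.re ⟪x, laplaceALatticeK ((η : ℂ))⁻¹ (adTransportW φ U) (adTransportW φ fun b => (U b)⁻¹) Δ₁ (RofUk L m n φ η U)
              (QkW L m n φ U hL αU hα1 hU1 hreg (c₁ := c₁)) a x⟫_ℂ) ∧
        -- (c) the Green's functions differ by `O(θ)` in the flat energy norm
        (∀ (hpos₁ : ∀ x : BondL2K ℂ d (towerP L m (n + 1)) c₀ W, x ≠ 0 →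
            0 < RCLike.re ⟪x, laplaceALatticeK ((η : ℂ))⁻¹ (adTransportW φ U) (adTransportW φ fun b => (U b)⁻¹) Δ₁ (RofUk L m n φ η U)
              (QkW L m n φ U hL αU hα1 hU1 hreg (c₁ := c₁)) a x⟫_ℂ)
          (hposU : ∀ x : BondL2K ℂ d (towerP L m (n + 1)) c₀ W, x ≠ 0 →
            0 < RCLike.re ⟪x, laplaceAk L m n φ η U hL αU hα1 hU1 hreg τ (c₀ := c₀) (c₁ := c₁) a x⟫_ℂ)
          (y : BondL2K ℂ d (towerP L m (n + 1)) c₀ W),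
          ‖greenK (laplaceALatticeK ((η : ℂ))⁻¹ (adTransportW φ U) (adTransportW φ fun b => (U b)⁻¹) Δ₁ (RofUk L m n φ η U)
              (QkW L m n φ U hL αU hα1 hU1 hreg (c₁ := c₁)) a) hpos₁ y -
            greenK (laplaceAk L m n φ η U hL αU hα1 hU1 hreg τ (c₀ := c₀) (c₁ := c₁) a) hposU y‖ ≤ 2 / γ₁ ^ 2 * θ * ‖y‖ ∧
          ‖covCurlL2K ℂ c₀ ((η : ℂ))⁻¹ (adTransportW φ (fun _ : Bond d (towerP L m (n + 1)) => (1 : 𝔸ˣ)))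
            (greenK (laplaceALatticeK ((η : ℂ))⁻¹ (adTransportW φ U) (adTransportW φ fun b => (U b)⁻¹) Δ₁ (RofUk L m n φ η U)
              (QkW L m n φ U hL αU hα1 hU1 hreg (c₁ := c₁)) a) hpos₁ y -
            greenK (laplaceAk L m n φ η U hL αU hα1 hU1 hreg τ (c₀ := c₀) (c₁ := c₁) a) hposU y)‖ ≤ 2 / γ₁ ^ 2 * θ * ‖y‖ ∧
          ‖covDivL2K ℂ c₀ ((η : ℂ))⁻¹ (adTransportW φ fun _ : Bond d (towerP L m (n + 1)) => (1 : 𝔸ˣ)⁻¹)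
            (greenK (laplaceALatticeK ((η : ℂ))⁻¹ (adTransportW φ U) (adTransportW φ fun b => (U b)⁻¹) Δ₁ (RofUk L m n φ η U)
              (QkW L m n φ U hL αU hα1 hU1 hreg (c₁ := c₁)) a) hpos₁ y -
            greenK (laplaceAk L m n φ η U hL αU hα1 hU1 hreg τ (c₀ := c₀) (c₁ := c₁) a) hposU y)‖ ≤ 2 / γ₁ ^ 2 * θ * ‖y‖) := by
  obtain ⟨α₀, γ₁, hα₀, hγ₁, H⟩ := exists_energy_letters_diagonal_closed (d := d) L hL φ hMφ hMφ' hφ hφ' ha hr0 hr1 τ hτ hCτ hρw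
  refine ⟨α₀, γ₁, hα₀, hγ₁, ?_⟩
  intro n η hηL c₀ c₁ _ _ hw hρ m _ U αU hα1 hU1 hreg εU hεU hUε α hα0 hαle hRS hUb hUη hpl hεg Δ₁ θ hθ0 hθle hθ
  have hγ2 : 0 < γ₁ / 2 := by positivity
  have HU := H n η hηL c₀ c₁ hw hρ m U αU hα1 hU1 hreg εU hεU hUε hα0 hαle hRS hUb hUη hpl hεg
  -- the flat energy weight `N₁` (opaque)
  obtain ⟨N, hNdef⟩ : ∃ N : BondL2K ℂ d (towerP L m (n + 1)) c₀ W → ℝ, N = fun z =>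
      Real.sqrt (‖covCurlL2K ℂ c₀ ((η : ℂ))⁻¹ (adTransportW φ (fun _ : Bond d (towerP L m (n + 1)) => (1 : 𝔸ˣ))) z‖ ^ 2 +
        ‖covDivL2K ℂ c₀ ((η : ℂ))⁻¹ (adTransportW φ fun _ : Bond d (towerP L m (n + 1)) => (1 : 𝔸ˣ)⁻¹) z‖ ^ 2 + ‖z‖ ^ 2) := ⟨_, rfl⟩
  have hNz : ∀ z, N z = Real.sqrt (‖covCurlL2K ℂ c₀ ((η : ℂ))⁻¹ (adTransportW φ (fun _ : Bond d (towerP L m (n + 1)) => (1 : 𝔸ˣ))) z‖ ^ 2 +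
        ‖covDivL2K ℂ c₀ ((η : ℂ))⁻¹ (adTransportW φ fun _ : Bond d (towerP L m (n + 1)) => (1 : 𝔸ˣ)⁻¹) z‖ ^ 2 + ‖z‖ ^ 2) := fun z => by rw [hNdef]
  have hN0 : ∀ z, 0 ≤ N z := fun z => by rw [hNz]; exact Real.sqrt_nonneg _
  have hNsq : ∀ z, N z ^ 2 = ‖covCurlL2K ℂ c₀ ((η : ℂ))⁻¹ (adTransportW φ (fun _ : Bond d (towerP L m (n + 1)) => (1 : 𝔸ˣ))) z‖ ^ 2 +
        ‖covDivL2K ℂ c₀ ((η : ℂ))⁻¹ (adTransportW φ fun _ : Bond d (towerP L m (n + 1)) => (1 : 𝔸ˣ)⁻¹) z‖ ^ 2 + ‖z‖ ^ 2 := fun z => by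
    rw [hNz]; exact Real.sq_sqrt (add_nonneg (add_nonneg (sq_nonneg _) (sq_nonneg _)) (sq_nonneg _))
  have hNn : ∀ z, ‖z‖ ≤ N z := fun z => by
    rw [hNz]; exact le_sqrt_of_sq_le (norm_nonneg _) (le_add_of_nonneg_left (add_nonneg (sq_nonneg _) (sq_nonneg _)))
  have hNc : ∀ z, ‖covCurlL2K ℂ c₀ ((η : ℂ))⁻¹ (adTransportW φ (fun _ : Bond d (towerP L m (n + 1)) => (1 : 𝔸ˣ))) z‖ ≤ N z := fun z => by
    rw [hNz]; exact le_sqrt_of_sq_le (norm_nonneg _) ((le_add_of_nonneg_right (sq_nonneg _)).trans (le_add_of_nonneg_right (sq_nonneg _)))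
  have hNd : ∀ z, ‖covDivL2K ℂ c₀ ((η : ℂ))⁻¹ (adTransportW φ fun _ : Bond d (towerP L m (n + 1)) => (1 : 𝔸ˣ)⁻¹) z‖ ≤ N z := fun z => by
    rw [hNz]; exact le_sqrt_of_sq_le (norm_nonneg _) ((le_add_of_nonneg_left (sq_nonneg _)).trans (le_add_of_nonneg_right (sq_nonneg _)))
  -- the form defect read in the weight
  have hθN : ∀ u v : BondL2K ℂ d (towerP L m (n + 1)) c₀ W, ‖⟪u, Δ₁ v⟫_ℂ - ⟪u, hessOp φ η U τ v⟫_ℂ‖ ≤ θ * N u * N v := fun u v => by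
    rw [hNz u, hNz v, mul_assoc]; exact (hθ u v).trans_eq (by ring)
  -- the two operators differ by the slot only
  have key : ∀ u v : BondL2K ℂ d (towerP L m (n + 1)) c₀ W,
      ⟪u, laplaceALatticeK ((η : ℂ))⁻¹ (adTransportW φ U) (adTransportW φ fun b => (U b)⁻¹) Δ₁ (RofUk L m n φ η U)
          (QkW L m n φ U hL αU hα1 hU1 hreg (c₁ := c₁)) a v⟫_ℂ -
        ⟪u, laplaceAk L m n φ η U hL αU hα1 hU1 hreg τ (c₀ := c₀) (c₁ := c₁) a v⟫_ℂ = ⟪u, Δ₁ v⟫_ℂ - ⟪u, hessOp φ η U τ v⟫_ℂ := by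
    intro u v
    simp only [laplaceAk, laplaceALatticeK, laplaceAK_apply, inner_add_right]
    ring
  have hT : ∀ u v : BondL2K ℂ d (towerP L m (n + 1)) c₀ W,
      ‖⟪u, laplaceALatticeK ((η : ℂ))⁻¹ (adTransportW φ U) (adTransportW φ fun b => (U b)⁻¹) Δ₁ (RofUk L m n φ η U)
          (QkW L m n φ U hL αU hα1 hU1 hreg (c₁ := c₁)) a v⟫_ℂ -
        ⟪u, laplaceAk L m n φ η U hL αU hα1 hU1 hreg τ (c₀ := c₀) (c₁ := c₁) a v⟫_ℂ‖ ≤ θ * N u * N v := fun u v => by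
    rw [key]; exact hθN u v
  -- (a) strong coercivity of the perturbed operator
  have hcoer1 : ∀ x : BondL2K ℂ d (towerP L m (n + 1)) c₀ W, γ₁ / 2 * N x ^ 2 ≤
      RCLike.re ⟪x, laplaceALatticeK ((η : ℂ))⁻¹ (adTransportW φ U) (adTransportW φ fun b => (U b)⁻¹) Δ₁ (RofUk L m n φ η U)
        (QkW L m n φ U hL αU hα1 hU1 hreg (c₁ := c₁)) a x⟫_ℂ := by
    intro x
    have h0 : γ₁ * N x ^ 2 ≤ RCLike.re ⟪x, laplaceAk L m n φ η U hL αU hα1 hU1 hreg τ (c₀ := c₀) (c₁ := c₁) a x⟫_ℂ := by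
      rw [hNsq]; exact (HU x).1
    have h1 := re_sub_ge (hT x x)
    have h2 : θ * N x * N x ≤ γ₁ / 2 * N x ^ 2 := by
      rw [mul_assoc, ← sq]; exact mul_le_mul_of_nonneg_right hθle (sq_nonneg _)
    linarith
  have hcoerU : ∀ x : BondL2K ℂ d (towerP L m (n + 1)) c₀ W, γ₁ * N x ^ 2 ≤
      RCLike.re ⟪x, laplaceAk L m n φ η U hL αU hα1 hU1 hreg τ (c₀ := c₀) (c₁ := c₁) a x⟫_ℂ := fun x => by rw [hNsq]; exact (HU x).1
  refine ⟨fun x => ?_, fun x hx => ?_, fun hpos₁ hposU y => ?_⟩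
  · rw [← hNsq]; exact hcoer1 x
  · have h1 := hcoer1 x
    have h2 : 0 < N x ^ 2 := by
      have h3 : 0 < ‖x‖ := norm_pos_iff.2 hx
      exact pow_pos (lt_of_lt_of_le h3 (hNn x)) 2
    nlinarith
  · -- (c) `B9Eq386GreenLipschitzEnergy`: `T₀` := the chain's operator, `T₁` := the perturbed one
    have hG0 : ∀ y, N (greenK (laplaceAk L m n φ η U hL αU hα1 hU1 hreg τ (c₀ := c₀) (c₁ := c₁) a) hposU y) ≤ γ₁⁻¹ * ‖y‖ :=
      fun y => weight_green_le (𝕜 := ℂ) hposU N hN0 hNn hγ₁ hcoerU y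
    have hz : N (greenK (laplaceAk L m n φ η U hL αU hα1 hU1 hreg τ (c₀ := c₀) (c₁ := c₁) a) hposU y -
        greenK (laplaceALatticeK ((η : ℂ))⁻¹ (adTransportW φ U) (adTransportW φ fun b => (U b)⁻¹) Δ₁ (RofUk L m n φ η U)
          (QkW L m n φ U hL αU hα1 hU1 hreg (c₁ := c₁)) a) hpos₁ y) ≤ θ / (γ₁ / 2) * γ₁⁻¹ * ‖y‖ :=
      weight_green_sub_le_of_bound (𝕜 := ℂ) hposU hpos₁ N hN0 hγ2 hθ0 hcoer1 hT hG0 y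
    have hC : θ / (γ₁ / 2) * γ₁⁻¹ * ‖y‖ = 2 / γ₁ ^ 2 * θ * ‖y‖ := by
      field_simp
    rw [hC] at hz
    have hneg : greenK (laplaceALatticeK ((η : ℂ))⁻¹ (adTransportW φ U) (adTransportW φ fun b => (U b)⁻¹) Δ₁ (RofUk L m n φ η U)
          (QkW L m n φ U hL αU hα1 hU1 hreg (c₁ := c₁)) a) hpos₁ y -
        greenK (laplaceAk L m n φ η U hL αU hα1 hU1 hreg τ (c₀ := c₀) (c₁ := c₁) a) hposU y =
        -(greenK (laplaceAk L m n φ η U hL αU hα1 hU1 hreg τ (c₀ := c₀) (c₁ := c₁) a) hposU y -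
          greenK (laplaceALatticeK ((η : ℂ))⁻¹ (adTransportW φ U) (adTransportW φ fun b => (U b)⁻¹) Δ₁ (RofUk L m n φ η U)
            (QkW L m n φ U hL αU hα1 hU1 hreg (c₁ := c₁)) a) hpos₁ y) := (neg_sub _ _).symm
    refine ⟨?_, ?_, ?_⟩
    · rw [hneg, norm_neg]; exact (hNn _).trans hz
    · rw [hneg, map_neg, norm_neg]; exact (hNc _).trans hz
    · rw [hneg, map_neg, norm_neg]; exact (hNd _).trans hz

end Literature.MathematicalPhysics.QuantumFieldTheory.Balaban1983to89.B9Eq3130HessianSlotPerturbationDiagonal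

end
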